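import Summits.CriticalPhenomena.CardyFormulaZ2.Theses.CardyDualCurrent
import Literature.Probability.LatticeModels.FermionicObservableSums
import Literature.Probability.LatticeModels.InterfaceRearrangement

/-!
# `NoDualCurrentRangeZero` (stmt-CriticalPhenomena-11204): reduction to the range-0 census certificate

The route item `CardyDualCurrent.NoDualCurrentRangeZero` says that no range-0 local parafermionic
template — a finite sum over `k` of a weight `g i k S` depending only on the state
`S ∈ {∅, {base}}` of the base edge of type `i`, times the winding phase `exp(-i (n i k / 3) W)` of a
passage of the percolation exploration interface through that edge — is exactly Duffin–CR at every
interior stencil of every admissible discrete Dobrushin domain (wired arc connected) and at the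
same time non-degenerate between 2-deep windows.

**What is proved here (sorry-free, no new definitions).** The integrand of the template's
observable at an interior medial vertex only sees the *effective coefficients*
`c(i, op, u) = ∑ k, g i k S_op · exp(-i (n_{ik}/3) (π u / 4))` at ODD integers `u`: an interior
passage of the exploration path has `windingAt ∈ (π/4)(2ℤ+1)` (arrival winding
`(π/2)·turnCount` plus half a quarter turn: `windingAt_explorationList`, `turnCount_succ`), and the
first/last vertices `e_a`, `e_b` of the path are never interior (`IsStartCorner`,
`isExitCorner_cornerOrbit`). Hence (`rangeZero_integrand_eq_zero`) a template whose effective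
coefficients vanish at all odd `u` has observable `G D x i = 0` at every interior edge of every
admissible domain — it is degenerate; so (`noDualCurrentRangeZero_of_certificate`) the item
follows from the **range-0 census certificate**: exact CR in all admissible domains forces
`c(i, op, u) = 0` for all `i`, `op` and odd `u`.

**Status of the certificate (evidence, not a Lean proof).** It is a finite exact computation: the
CR equations are linear in the 48 unknowns `c(i, op, u mod 24)` with dyadic-rational coefficients
(passage statistics of explicit small domains under `setBer(E(ℤ²), 1/2)`, by exhaustive
enumeration of the exploration paths). The census in this item's evidence (kit compute job
j017402 and the prover folder's `census/`) finds rank 48 — kernel `{0}` — from the three-sided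
boxes `threeSided 3 3, 4 2, 4 3`, the bar domains `barDomain 3 1 0, 3 2 0, 4 1 0, 4 1 1`
(`LatticeDobrushinBox.lean`) and four admissible ANNULAR lattice domains (a `9 × 6` box of sites
minus a `3 × 1` hole, wired arc = the middle site of one long side of the hole rim, everything
else in the free arc; arcs computed from the `infDist` definition of `zdDiscreteArc`). Two
structural facts found on the way: (i) on simply connected data the kernel is exactly the
8-dimensional space `N` of *pairing-null* templates (spins `n/3` with `n ≡ 2, 4, 8, 10 (mod 12)`,
weights `g ∅ = ∓ g {base}`), whose observable vanishes identically by the `q = 1` edge-flip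
involution (`InterfaceRearrangement.lean`: single ↔ double passage, the second passage `∓π`
later) — exactly CR but degenerate; (ii) `IsZdAdmissible` (with the wired arc preconnected)
admits multiply connected data, where the loop detached by the flip can be an outer boundary
(`+π` instead of `-π`), `N` is neither null nor CR, and the kernel drops to `{0}`. Turning the
certificate into a Lean proof needs a verified enumerator of `medialExploration` on explicit
lattice data (about `1.4 · 10^6` exploration paths, `2^14 … 2^30` local configurations) and
`IsZdAdmissible` for the annular data; neither is in the tree.
-/

namespace Summit.CriticalPhenomena.CardyFormulaZ2.Theorems

open Literature.Probability.LatticeModels Literature.Probability MeasureTheory Finset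

/-! ### Interior passages have odd winding class -/

/-- The running turn count changes by `±1` at each step, so `turnCount j + turnCount (j+1)` is odd.
[cite: Smirnov2010, §4 (the winding of the interface in quarter turns)] -/
theorem odd_turnCount_add_turnCount_succ (β : Percolation.BondConfig (Site 2)) (c₀ : Site 2 × Fin 4) (j : ℕ) :
    Odd (turnCount β c₀ j + turnCount β c₀ (j + 1)) := by
  rw [turnCount_succ]
  unfold turnSign
  split_ifs
  · exact ⟨turnCount β c₀ j - 1, by ring⟩
  · exact ⟨turnCount β c₀ j, by ring⟩

/-- **The winding at a position `k < N` of the exploration path is `(π/4) · (turnCount (k-1) + turnCount k)`**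
(arrival winding `(π/2) turnCount` averaged with the departure winding); for `0 < k` this is an odd
multiple of `π/4`. [cite: Smirnov2010, §2.2 (W_γ(z)) and §4] -/
theorem windingAt_explorationList_eq_pi_div_four (β : Percolation.BondConfig (Site 2)) {δ : ℝ} (hδ : δ ≠ 0)
    (c₀ : Site 2 × Fin 4) {k N : ℕ} (hk : k < N) :
    windingAt (explorationList β c₀ N) δ k =
      Real.pi / 4 * ((turnCount β c₀ (k - 1) + turnCount β c₀ k : ℤ) : ℝ) := by
  rw [windingAt_explorationList hδ c₀ hk, sum_turnOf_eq, sum_turnOf_eq]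
  have h1 : (turnCount β c₀ (k - 1) : ℝ) = ∑ i ∈ Finset.range (k - 1), (turnSign β (cornerOrbit β c₀ i) : ℝ) := by
    unfold turnCount; push_cast; rfl
  have h2 : (turnCount β c₀ k : ℝ) = ∑ i ∈ Finset.range k, (turnSign β (cornerOrbit β c₀ i) : ℝ) := by
    unfold turnCount; push_cast; rfl
  push_cast
  rw [h1, h2]
  ring

/-! ### The integrand of a template with vanishing effective coefficients -/

open scoped Classical in
/-- The range-0 local pattern: the set of medial vertices at medial distance `≤ 0` from the base
edge whose translate is open is `{base}` or `∅` according to the state of the translated base edge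
(`SimpleGraph.edist_eq_zero_iff`: reachability-aware distance `0` means equality). [folklore] -/
theorem rangeZero_pattern_eq (i : Fin 2) (x : Site 2) (cfg : Percolation.BondConfig (Site 2)) :
    {e | medialGraph.edist s((0 : Site 2), Pi.single i 1) e ≤ (0 : ℕ∞) ∧ Sym2.map (· + x) e ∈ cfg} =
      if Sym2.map (· + x) s((0 : Site 2), Pi.single i 1) ∈ cfg then {s((0 : Site 2), Pi.single i 1)} else ∅ := by
  ext e
  simp only [Set.mem_setOf_eq, nonpos_iff_eq_zero, SimpleGraph.edist_eq_zero_iff]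
  by_cases hc : Sym2.map (· + x) s((0 : Site 2), Pi.single i 1) ∈ cfg
  · rw [if_pos hc, Set.mem_singleton_iff]
    constructor
    · rintro ⟨h, -⟩
      exact h.symm
    · rintro rfl
      exact ⟨rfl, hc⟩
  · rw [if_neg hc]
    simp only [Set.mem_empty_iff_false, iff_false, not_and]
    rintro rfl
    exact hc

/-- An interior medial vertex contains no site of the wired arc. [cite: Smirnov2010, §4 (interior medial vertices)] -/
theorem not_mem_zdArcA_of_mem_innerMedialVertices {D : DiscreteDobrushin} {E : MedialVertex}
    (hE : E ∈ D.innerMedialVertices) {y : Site 2} (hy : y ∈ E) : y ∉ D.zdArcA :=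
  ((D.mem_innerMedialVertices_iff.1 hE).2 y hy).1

/-- **Passages of the exploration path through an interior medial vertex happen at interior
positions** `0 < j < N` (the first vertex is `e_a`, the last is `e_b`, both touch the wired arc).
[cite: Smirnov2001, §2] -/
theorem pos_and_lt_of_cSrc_cornerOrbit_mem_inner {D : DiscreteDobrushin} (hD : D.IsZdAdmissible)
    (cfg : Percolation.BondConfig (Site 2)) {E : MedialVertex} (hE : E ∈ D.innerMedialVertices) {j : ℕ}
    (hj : j < DiscreteDobrushin.exitTime hD cfg + 1)
    (hsrc : cSrc (cornerOrbit (D.bcBondConfig cfg) (DiscreteDobrushin.startCorner hD) j) = E) :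
    0 < j ∧ j < DiscreteDobrushin.exitTime hD cfg := by
  set c₀ := DiscreteDobrushin.startCorner hD
  set N := DiscreteDobrushin.exitTime hD cfg
  have hc₀ := DiscreteDobrushin.isStartCorner_startCorner hD
  constructor
  · by_contra h0
    have h0 : j = 0 := by omega
    subst h0
    change cSrc c₀ = E at hsrc
    refine not_mem_zdArcA_of_mem_innerMedialVertices hE ?_ hc₀.mem_zdArcA
    rw [← hsrc, cSrc]
    exact Sym2.mem_mk_left _ _
  · by_contra hN
    have hjN : j = N := by omega
    subst hjN
    have hNpos := DiscreteDobrushin.exitTime_pos hD cfg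
    obtain ⟨M, hM⟩ : ∃ M, DiscreteDobrushin.exitTime hD cfg = M + 1 := ⟨_, (Nat.succ_pred_eq_of_pos hNpos).symm⟩
    have hin : D.IsInnerFace (cFace (cornerOrbit (D.bcBondConfig cfg) c₀ M)) :=
      DiscreteDobrushin.isInnerFace_of_lt_exitTime hD cfg (by omega)
    have hout : ¬ D.IsInnerFace (cFace (cornerOrbit (D.bcBondConfig cfg) c₀ (M + 1))) := by
      rw [← hM]; exact DiscreteDobrushin.not_isInnerFace_exitTime hD cfg
    have hexit := isExitCorner_cornerOrbit hD hc₀ hin hout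
    refine not_mem_zdArcA_of_mem_innerMedialVertices hE ?_ hexit.mem_zdArcA
    rw [← hsrc]
    change (cornerOrbit (D.bcBondConfig cfg) c₀ M).1 ∈ cSrc (cornerOrbit (D.bcBondConfig cfg) c₀ (DiscreteDobrushin.exitTime hD cfg))
    rw [hM, cSrc_cornerOrbit_succ, cTgt]
    exact Sym2.mem_mk_left _ _

/-- **The integrand of a range-0 template whose effective coefficients vanish at odd winding
classes vanishes pointwise** at every interior medial vertex of every admissible domain, for
every configuration: the passages of the exploration path through the base edge happen at
interior positions, where the winding is an odd multiple of `π/4`, and the local pattern is the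
state of the base edge. [folklore] -/
theorem rangeZero_integrand_eq_zero {m : ℕ} {n : Fin 2 → Fin m → ℤ} {g : Fin 2 → Fin m → Set MedialVertex → ℂ}
    {i : Fin 2}
    (hcoef : ∀ (op : Bool) (u : ℤ), Odd u →
      (∑ k, g i k (if op then {s((0 : Site 2), Pi.single i 1)} else ∅) *
          Complex.exp (-Complex.I * (((n i k : ℝ) / 3 : ℝ) : ℂ) * ((Real.pi / 4 * (u : ℝ) : ℝ) : ℂ))) = 0)
    {D : DiscreteDobrushin} (hD : D.IsZdAdmissible) {x : Site 2}
    (hE : Sym2.map (· + x) s((0 : Site 2), Pi.single i 1) ∈ D.innerMedialVertices)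
    (cfg : Percolation.BondConfig (Site 2)) :
    (∑ k, g i k {e | medialGraph.edist s((0 : Site 2), Pi.single i 1) e ≤ (0 : ℕ∞) ∧ Sym2.map (· + x) e ∈ cfg} *
      passageSum (fkInterface D cfg) D.δ ((n i k : ℝ) / 3) (Sym2.map (· + x) s((0 : Site 2), Pi.single i 1))) = 0 := by
  classical
  set E := Sym2.map (· + x) s((0 : Site 2), Pi.single i 1) with hEdef
  set β := D.bcBondConfig cfg
  set c₀ := DiscreteDobrushin.startCorner hD
  set N := DiscreteDobrushin.exitTime hD cfg
  have hδ : D.δ ≠ 0 := hD.delta_pos.ne'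
  have hγ : fkInterface D cfg = explorationList β c₀ N := DiscreteDobrushin.medialExploration_eq_explorationList hD cfg
  rw [rangeZero_pattern_eq, hγ]
  simp_rw [passageSum_explorationList, Finset.mul_sum]
  rw [Finset.sum_comm]
  refine Finset.sum_eq_zero fun j hj => ?_
  rw [Finset.mem_filter, Finset.mem_range] at hj
  obtain ⟨hj0, hjN⟩ := pos_and_lt_of_cSrc_cornerOrbit_mem_inner hD cfg hE hj.1 hj.2
  rw [windingAt_explorationList_eq_pi_div_four β hδ c₀ hjN]
  have hodd : Odd (turnCount β c₀ (j - 1) + turnCount β c₀ j) := by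
    have := odd_turnCount_add_turnCount_succ β c₀ (j - 1)
    rwa [show j - 1 + 1 = j by omega] at this
  by_cases hc : E ∈ cfg
  · rw [if_pos hc]
    have h := hcoef true _ hodd
    simp only [↓reduceIte] at h
    exact h
  · rw [if_neg hc]
    have h := hcoef false _ hodd
    simp only [Bool.false_eq_true, ↓reduceIte] at h
    exact h

/-- **The observable of a range-0 template whose effective coefficients vanish at odd winding
classes vanishes at every interior edge of every admissible domain** (so the template is
degenerate there). [folklore] -/
theorem rangeZero_observable_eq_zero {m : ℕ} {z : Fin 2 → Fin m → MedialVertex} {n : Fin 2 → Fin m → ℤ}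
    {g : Fin 2 → Fin m → Set MedialVertex → ℂ}
    (hz : ∀ i k, medialGraph.edist s((0 : Site 2), Pi.single i 1) (z i k) ≤ (0 : ℕ∞)) {i : Fin 2}
    (hcoef : ∀ (op : Bool) (u : ℤ), Odd u →
      (∑ k, g i k (if op then {s((0 : Site 2), Pi.single i 1)} else ∅) *
          Complex.exp (-Complex.I * (((n i k : ℝ) / 3 : ℝ) : ℂ) * ((Real.pi / 4 * (u : ℝ) : ℝ) : ℂ))) = 0)
    {D : DiscreteDobrushin} (hD : D.IsZdAdmissible) {x : Site 2}
    (hE : Sym2.map (· + x) s((0 : Site 2), Pi.single i 1) ∈ D.innerMedialVertices) :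
    (∫ cfg, (∑ k, g i k {e | medialGraph.edist s((0 : Site 2), Pi.single i 1) e ≤ (0 : ℕ∞) ∧
        Sym2.map (· + x) e ∈ cfg} * passageSum (fkInterface D cfg) D.δ ((n i k : ℝ) / 3) (Sym2.map (· + x) (z i k)))
      ∂(Percolation.bondPercolation (zdGraph 2) Percolation.half)) = 0 := by
  have hz' : ∀ k, z i k = s((0 : Site 2), Pi.single i 1) := fun k => by
    have := hz i k
    rw [nonpos_iff_eq_zero, SimpleGraph.edist_eq_zero_iff] at this
    exact this.symm
  simp_rw [hz']
  simp_rw [rangeZero_integrand_eq_zero hcoef hD hE]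
  exact integral_zero _ _

/-- **Reduction of the route item to the range-0 census certificate.** Hypothesis `hcert` (the
certificate — a finite exact computation, see the module docstring; NOT proved in Lean): for
every range-0 template `(z, n, g)` (passage vertices at medial distance `0` from the base edge),
the Cauchy–Riemann clause of the item (verbatim: vertex and face Duffin relations at every stencil
with four interior radius-0 windows, in every admissible domain with preconnected wired arc)
forces every effective coefficient `∑ k, g i k S_op · exp(-i (n i k/3)(π u/4))` at odd `u` to
vanish. Conclusion: `NoDualCurrentRangeZero`. Proof: such a template has observable `0` at all
interior edges (`rangeZero_observable_eq_zero`), in particular at the two 2-deep windows of the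
non-degeneracy clause, which therefore fails. [folklore] -/
theorem noDualCurrentRangeZero_of_certificate
    (hcert : ∀ (m : ℕ) (z : Fin 2 → Fin m → MedialVertex) (n : Fin 2 → Fin m → ℤ)
      (g : Fin 2 → Fin m → Set MedialVertex → ℂ),
      (∀ i k, medialGraph.edist s((0 : Site 2), Pi.single i 1) (z i k) ≤ (0 : ℕ∞)) →
      (let G : Literature.Probability.LatticeModels.DiscreteDobrushin → Literature.Probability.LatticeModels.Site 2 → Fin 2 → ℂ := fun D x i => ∫ cfg, (∑ k, g i k {e | Literature.Probability.LatticeModels.medialGraph.edist s((0 : Literature.Probability.LatticeModels.Site 2), Pi.single i 1) e ≤ (0 : ℕ∞) ∧ Sym2.map (· + x) e ∈ cfg} * Literature.Probability.LatticeModels.passageSum (Literature.Probability.LatticeModels.fkInterface D cfg) D.δ ((n i k : ℝ) / 3) (Sym2.map (· + x) (z i k))) ∂(Literature.Probability.Percolation.bondPercolation (Literature.Probability.LatticeModels.zdGraph 2) Literature.Probability.Percolation.half);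
        let W : Literature.Probability.LatticeModels.DiscreteDobrushin → Literature.Probability.LatticeModels.Site 2 → Fin 2 → ℕ → Prop := fun D x i ρ => ∀ e, Literature.Probability.LatticeModels.medialGraph.edist s((0 : Literature.Probability.LatticeModels.Site 2), Pi.single i 1) e ≤ (ρ : ℕ∞) → Sym2.map (· + x) e ∈ D.innerMedialVertices;
        (∀ D : Literature.Probability.LatticeModels.DiscreteDobrushin, D.IsZdAdmissible → ((Literature.Probability.LatticeModels.discreteDomainGraph D.Ω D.δ).induce D.zdArcA).Preconnected →
          (∀ x, W D x 0 0 → W D x 1 0 → W D (x - Pi.single 0 1) 0 0 → W D (x - Pi.single 1 1) 1 0 → G D x 1 - G D (x - Pi.single 1 1) 1 = Complex.I * (G D x 0 - G D (x - Pi.single 0 1) 0)) ∧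
          (∀ f, W D f 0 0 → W D (f + Pi.single 1 1) 0 0 → W D f 1 0 → W D (f + Pi.single 0 1) 1 0 → G D (f + Pi.single 1 1) 0 - G D f 0 = Complex.I * (G D (f + Pi.single 0 1) 1 - G D f 1)))) →
      ∀ (i : Fin 2) (op : Bool) (u : ℤ), Odd u →
        (∑ k, g i k (if op then {s((0 : Site 2), Pi.single i 1)} else ∅) *
          Complex.exp (-Complex.I * (((n i k : ℝ) / 3 : ℝ) : ℂ) * ((Real.pi / 4 * (u : ℝ) : ℝ) : ℂ))) = 0) :
    Summit.CriticalPhenomena.CardyFormulaZ2.Theses.CardyDualCurrent.NoDualCurrentRangeZero := by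
  rintro ⟨m, z, n, g, hz, hrest⟩
  obtain ⟨hCR, hND⟩ := hrest
  have h0 := hcert m z n g hz hCR
  apply hND
  intro D hD _ x x' i hW hW'
  have hbase : medialGraph.edist s((0 : Site 2), Pi.single i 1) s((0 : Site 2), Pi.single i 1) ≤ ((2 : ℕ) : ℕ∞) := by
    rw [SimpleGraph.edist_self]; exact bot_le
  have e1 := rangeZero_observable_eq_zero hz (h0 i) hD (hW _ hbase)
  have e2 := rangeZero_observable_eq_zero hz (h0 i) hD (hW' _ hbase)
  dsimp only
  rw [e1, e2]

end Summit.CriticalPhenomena.CardyFormulaZ2.Theorems
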